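import Mathlib
import Summits.Ventures.PercRepro2.HCov
import Summits.Ventures.PercRepro2.SevenClass
import Summits.Ventures.PercRepro2.GcSkelRules
import Summits.Ventures.PercRepro2.GcSkelReduction
import Summits.Ventures.PercRepro2.GcSkelReductionS
import Summits.Ventures.PercRepro2.GcSkelReductionC
import Summits.Ventures.PercRepro2.HubClassesAll
import Summits.Ventures.PercRepro2.GcSkelReductionR
import Summits.Ventures.PercRepro2.GcSkelReductionN
import Summits.Ventures.PercRepro2.GcSkelReductionB

/-!
# The residual minus the certified seven-vertex skeletons (blind cell PercRepro2, typer-1 g52)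

mine-2 g34's `Seven.SevenSkelClass ends o a₁ a₂ a₃ b` (SevenClass.lean): the graph is, up to an
injective relabelling carrying the marks to `0 … 4`, a subgraph of a seven-vertex twelve-edge
skeleton with a kernel certificate (`Seven.Cert`); `HCov_of_sevenSkelClass` and its root mirror
`HCov_of_sevenSkelClass'` are (HCOV) theorems. Two more clauses of the weighted residual:
**`WReducedSeven`** := `WReducedB` ∧ not seven-skeleton at `(o, a₁, a₂, a₃, b)` nor at
`(o, a₂, a₁, a₃, b)`; **`HCov_all_iff_HCovWRedSeven_all`**.
-/

namespace Summit.Ventures.PercRepro2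

open CovForm

namespace WRed

section ClassSeven

variable {V : Type*} {E : Type*} [Fintype E] [DecidableEq E] [DecidableEq V]

/-- **The residual minus the certified seven-vertex skeletons**: `WReducedB`, and the instance is
not in `Seven.SevenSkelClass` in either root order. -/
structure WReducedSeven (ends : E → Sym2 V) (o a₁ a₂ a₃ b : V) : Prop
    extends WReducedB ends o a₁ a₂ a₃ b where
  /-- not a subgraph of a certified seven-vertex skeleton, marks in order -/
  notSeven : ¬ Seven.SevenSkelClass ends o a₁ a₂ a₃ b
  /-- not a subgraph of a certified seven-vertex skeleton, roots swapped -/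
  notSeven' : ¬ Seven.SevenSkelClass ends o a₂ a₁ a₃ b

end ClassSeven

section Closure

variable (R : Type*) [Field R] [LinearOrder R] [IsStrictOrderedRing R]

/-- **(HCOV) on the residual minus the certified seven-vertex skeletons**. -/
def HCovWRedSeven_all : Prop :=
  ∀ (V E : Type) [Fintype V] [DecidableEq V] [Fintype E] [DecidableEq E]
    (ends : E → Sym2 V) (p : E → R), IsProbVec p →
    ∀ o a₁ a₂ a₃ b : V, a₁ ≠ a₂ → a₁ ≠ a₃ → a₂ ≠ a₃ → o ≠ a₁ → o ≠ a₂ → o ≠ a₃ → o ≠ b →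
      b ≠ a₁ → b ≠ a₂ → b ≠ a₃ → WReducedSeven ends o a₁ a₂ a₃ b → HCov p ends o a₁ a₂ a₃ b

end Closure

section Main

variable {R : Type*} [Field R] [LinearOrder R] [IsStrictOrderedRing R]

/-- (HCOV) on `WReducedB` follows from (HCOV) on `WReducedSeven`: the seven-skeleton classes are
theorems. -/
theorem HCovWRedB_all_of_HCovWRedSeven_all (hB : HCovWRedSeven_all R) : HCovWRedB_all R := by
  intro V E _ _ _ _ ends p hp o a₁ a₂ a₃ b h12 h13 h23 ho1 ho2 ho3 hob hb1 hb2 hb3 hred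
  by_cases h7 : Seven.SevenSkelClass ends o a₁ a₂ a₃ b
  · exact Seven.HCov_of_sevenSkelClass ends o a₁ a₂ a₃ b h7 p hp
  by_cases h7' : Seven.SevenSkelClass ends o a₂ a₁ a₃ b
  · exact Seven.HCov_of_sevenSkelClass' ends o a₁ a₂ a₃ b h7' p hp
  exact hB V E ends p hp o a₁ a₂ a₃ b h12 h13 h23 ho1 ho2 ho3 hob hb1 hb2 hb3 ⟨hred, h7, h7'⟩

/-- **THE WEIGHTED RESIDUAL MINUS THE CERTIFIED SEVEN-VERTEX SKELETONS**: (HCOV) for every finite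
weighted graph with five distinct marks follows from (HCOV) on `WReducedSeven`. -/
theorem HCov_all_of_HCovWRedSeven_all (hB : HCovWRedSeven_all R) : HCov_all R :=
  HCov_all_of_HCovWRedB_all (HCovWRedB_all_of_HCovWRedSeven_all hB)

/-- The residual minus the certified seven-vertex skeletons is a faithful reduction. -/
theorem HCov_all_iff_HCovWRedSeven_all : HCov_all R ↔ HCovWRedSeven_all R :=
  ⟨fun h V E _ _ _ _ ends p hp o a₁ a₂ a₃ b h12 h13 h23 ho1 ho2 ho3 hob hb1 hb2 hb3 _ =>
    h V E ends p hp o a₁ a₂ a₃ b h12 h13 h23 ho1 ho2 ho3 hob hb1 hb2 hb3,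
   HCov_all_of_HCovWRedSeven_all⟩

end Main

end WRed

end Summit.Ventures.PercRepro2
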